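import Literature.NumberTheory.Sieve.CubicFormClassBrunTitchmarsh
import HarnessLib

/-!
# Prime values of `x³ + 2y³` in a class, on thin strips, PROVED

Topic `Literature/NumberTheory/Sieve`, namespace `Literature.NumberTheory.Sieve.CubicPrimes`
(continuation of `CubicFormClassBrunTitchmarsh.lean`).

The class Brun–Titchmarsh bound `card_classBoxPairs_prime_le`
(`#{(x, y) ∈ classBoxPairs A A' L d a b : x³ + 2y³ prime} ≤ C·ccw(d)·(L/d)²/log(L/d)` for
`L/d ≥ L₀`, [HeathBrownMoroz2004, §3 (3.1)–(3.3) with HalberstamRichert1974, Thm 2.2]) summed over a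
row of `k` adjacent squares of side `S` bounds the prime values in the class `(a, b) mod d` on a
strip `(A, A + kS] × (B, B + S]` (and on the transposed strip) by `k · C·ccw(d)·(S/d)²/log(S/d)`
(`card_classStrip_prime_le`).  This is the covering step (β) of the parity-ideate route
`GoldbachHeathBrownDispersion`'s support item «ClassTransfer» (ii): the symmetric difference of
Heath-Brown's box and the rescaled Heath-Brown–Moroz box lies in three such strips.  No new facts.
Written for the parity-ideate cell (literature seat g14, 2026-08-27).

## References

* [HeathBrownMoroz2004] D. R. Heath-Brown, B. Z. Moroz, Proc. LMS (3) 88 (2004), §3 (3.1)–(3.3).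
* [HalberstamRichert1974] H. Halberstam, H.-E. Richert, *Sieve Methods*, Thm 2.2.
-/

noncomputable section

open Finset

namespace Literature.NumberTheory.Sieve.CubicPrimes

/-- A long interval is covered by `k` adjacent intervals of length `S`:
`(A, A + kS] ⊆ ⋃_{j<k} (A + jS, A + jS + S]`. [folklore] -/
private theorem mem_Ioc_mul_exists {A S k x : ℕ} (hS : 0 < S) (hx : x ∈ Ioc A (A + k * S)) :
    ∃ j ∈ range k, x ∈ Ioc (A + j * S) (A + j * S + S) := by
  rw [mem_Ioc] at hx
  refine ⟨(x - A - 1) / S, ?_, ?_⟩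
  · rw [mem_range, Nat.div_lt_iff_lt_mul hS]
    omega
  · rw [mem_Ioc]
    have h1 := Nat.div_mul_le_self (x - A - 1) S
    have h2 : x - A - 1 < ((x - A - 1) / S + 1) * S := by
      rw [← Nat.div_lt_iff_lt_mul hS]; exact Nat.lt_succ_self _
    rw [add_mul, one_mul] at h2
    set q := (x - A - 1) / S * S with hq
    omega

/-- **Prime values in a class on a horizontal strip of `k` squares**: with the constants `C, L₀` of
`card_classBoxPairs_prime_le`, for `(a³ + 2b³, d) = 1` and `S/d ≥ L₀`,
`#{(x, y) : A < x ≤ A + kS, B < y ≤ B + S, x ≡ a, y ≡ b (mod d), x³ + 2y³ prime}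
≤ k · C·ccw(d)·(S/d)²/log(S/d)`; likewise on the transposed (vertical) strip.
[cite: HeathBrownMoroz2004, §3 (3.1)–(3.3) (upper-bound sieve in a class, summed over squares)] -/
theorem card_classStrip_prime_le :
    ∃ C L₀ : ℝ, 0 < C ∧ ∀ (A B S k d a b : ℕ), 0 < d → Nat.Coprime (a ^ 3 + 2 * b ^ 3) d →
      L₀ ≤ (S : ℝ) / d →
      (#{xy ∈ Ioc A (A + k * S) ×ˢ Ioc B (B + S) |
          xy.1 ≡ a [MOD d] ∧ xy.2 ≡ b [MOD d] ∧ (xy.1 ^ 3 + 2 * xy.2 ^ 3).Prime} : ℝ) ≤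
        k * (C * coprimeClassWeight d * ((S : ℝ) / d) ^ 2 / Real.log ((S : ℝ) / d)) ∧
      (#{xy ∈ Ioc A (A + S) ×ˢ Ioc B (B + k * S) |
          xy.1 ≡ a [MOD d] ∧ xy.2 ≡ b [MOD d] ∧ (xy.1 ^ 3 + 2 * xy.2 ^ 3).Prime} : ℝ) ≤
        k * (C * coprimeClassWeight d * ((S : ℝ) / d) ^ 2 / Real.log ((S : ℝ) / d)) := by
  obtain ⟨C, L₀, hC, hbox⟩ := card_classBoxPairs_prime_le
  -- make `L₀ ≥ 1`, so that `S/d ≥ L₀` forces `S > 0`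
  refine ⟨C, max L₀ 1, hC, fun A B S k d a b hd hab hS => ?_⟩
  have hL₀ : L₀ ≤ (S : ℝ) / d := (le_max_left _ _).trans hS
  have hd' : (0 : ℝ) < d := by exact_mod_cast hd
  have hS0 : 0 < S := by
    have h1 : (1 : ℝ) ≤ (S : ℝ) / d := (le_max_right _ _).trans hS
    rw [le_div_iff₀ hd'] at h1
    exact_mod_cast (show (0 : ℝ) < S by linarith)
  have hsq : ∀ A₁ B₁ : ℕ,
      (#{xy ∈ classBoxPairs A₁ B₁ S d a b | (xy.1 ^ 3 + 2 * xy.2 ^ 3).Prime} : ℝ) ≤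
        C * coprimeClassWeight d * ((S : ℝ) / d) ^ 2 / Real.log ((S : ℝ) / d) :=
    fun A₁ B₁ => hbox A₁ B₁ S d a b hd hab hL₀
  constructor
  · -- horizontal strip ⊆ ⋃_{j<k} squares `(A + jS, A + jS + S] × (B, B + S]`
    have hsub : {xy ∈ Ioc A (A + k * S) ×ˢ Ioc B (B + S) |
          xy.1 ≡ a [MOD d] ∧ xy.2 ≡ b [MOD d] ∧ (xy.1 ^ 3 + 2 * xy.2 ^ 3).Prime} ⊆
        (range k).biUnion fun j =>
          {xy ∈ classBoxPairs (A + j * S) B S d a b | (xy.1 ^ 3 + 2 * xy.2 ^ 3).Prime} := by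
      intro xy hxy
      rw [mem_filter, mem_product] at hxy
      obtain ⟨⟨hx, hy⟩, hxa, hyb, hpr⟩ := hxy
      obtain ⟨j, hj, hxj⟩ := mem_Ioc_mul_exists hS0 hx
      rw [mem_biUnion]
      refine ⟨j, hj, ?_⟩
      rw [mem_filter, mem_classBoxPairs_iff]
      exact ⟨⟨mem_Ioc.mp hxj, hxa, mem_Ioc.mp hy, hyb⟩, hpr⟩
    have hnat : #{xy ∈ Ioc A (A + k * S) ×ˢ Ioc B (B + S) |
          xy.1 ≡ a [MOD d] ∧ xy.2 ≡ b [MOD d] ∧ (xy.1 ^ 3 + 2 * xy.2 ^ 3).Prime} ≤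
        ∑ j ∈ range k,
          #{xy ∈ classBoxPairs (A + j * S) B S d a b | (xy.1 ^ 3 + 2 * xy.2 ^ 3).Prime} :=
      (card_le_card hsub).trans card_biUnion_le
    have hreal : (#{xy ∈ Ioc A (A + k * S) ×ˢ Ioc B (B + S) |
          xy.1 ≡ a [MOD d] ∧ xy.2 ≡ b [MOD d] ∧ (xy.1 ^ 3 + 2 * xy.2 ^ 3).Prime} : ℝ) ≤
        ∑ j ∈ range k,
          (#{xy ∈ classBoxPairs (A + j * S) B S d a b | (xy.1 ^ 3 + 2 * xy.2 ^ 3).Prime} : ℝ) := by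
      exact_mod_cast hnat
    refine hreal.trans ((sum_le_sum fun j _ => hsq (A + j * S) B).trans ?_)
    rw [sum_const, card_range, nsmul_eq_mul]
  · -- vertical strip ⊆ ⋃_{j<k} squares `(A, A + S] × (B + jS, B + jS + S]`
    have hsub : {xy ∈ Ioc A (A + S) ×ˢ Ioc B (B + k * S) |
          xy.1 ≡ a [MOD d] ∧ xy.2 ≡ b [MOD d] ∧ (xy.1 ^ 3 + 2 * xy.2 ^ 3).Prime} ⊆
        (range k).biUnion fun j =>
          {xy ∈ classBoxPairs A (B + j * S) S d a b | (xy.1 ^ 3 + 2 * xy.2 ^ 3).Prime} := by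
      intro xy hxy
      rw [mem_filter, mem_product] at hxy
      obtain ⟨⟨hx, hy⟩, hxa, hyb, hpr⟩ := hxy
      obtain ⟨j, hj, hyj⟩ := mem_Ioc_mul_exists hS0 hy
      rw [mem_biUnion]
      refine ⟨j, hj, ?_⟩
      rw [mem_filter, mem_classBoxPairs_iff]
      exact ⟨⟨mem_Ioc.mp hx, hxa, mem_Ioc.mp hyj, hyb⟩, hpr⟩
    have hnat : #{xy ∈ Ioc A (A + S) ×ˢ Ioc B (B + k * S) |
          xy.1 ≡ a [MOD d] ∧ xy.2 ≡ b [MOD d] ∧ (xy.1 ^ 3 + 2 * xy.2 ^ 3).Prime} ≤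
        ∑ j ∈ range k,
          #{xy ∈ classBoxPairs A (B + j * S) S d a b | (xy.1 ^ 3 + 2 * xy.2 ^ 3).Prime} :=
      (card_le_card hsub).trans card_biUnion_le
    have hreal : (#{xy ∈ Ioc A (A + S) ×ˢ Ioc B (B + k * S) |
          xy.1 ≡ a [MOD d] ∧ xy.2 ≡ b [MOD d] ∧ (xy.1 ^ 3 + 2 * xy.2 ^ 3).Prime} : ℝ) ≤
        ∑ j ∈ range k,
          (#{xy ∈ classBoxPairs A (B + j * S) S d a b | (xy.1 ^ 3 + 2 * xy.2 ^ 3).Prime} : ℝ) := by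
      exact_mod_cast hnat
    refine hreal.trans ((sum_le_sum fun j _ => hsq A (B + j * S)).trans ?_)
    rw [sum_const, card_range, nsmul_eq_mul]

end Literature.NumberTheory.Sieve.CubicPrimes

end
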